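import Summits.Ventures.PercRepro.S1TriangleBoundEight

/-!
# PercRepro — THE TRIANGLE BOUND `triBound10`: the bootstrap from the kernels `10` at nullity `6` and `12` at nullity `7`
with the (C3)-refined step (p8, gen 24; a feeder for S4 — the rows `≤ 36` of the `q = 7` window)

The bootstrapped triangle count at the point `x` on the fewest triangles (`m := t_x`, `F` the bound one nullity lower):
`2m² ≤ 2m + 3F` (the star `|U| ≥ 2m + 1` and the double count `|U|·m ≤ 3 s₃ ≤ 3m + 3F`), and THE RESTRICTION STEP at
nullity `ν = d + 1 ≥ 8`: either `M ↾ U` has smaller nullity (and the lower bound applies) or `|U| = r(U) + ν` with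
`r(U) ≥ 4` once `|U| ≥ 7` (C2), so `|U| ≥ 11` and `r(U) ≥ 5` (C3), giving `(d + 3)·m ≤ 3F` for every `m ≥ 3` (the (C3)
trigger taken from `|U| ≥ ν + 4`, p9 g29's refinement of S1TriangleBoundEight's `stepR`, which used it only for `m ≥ 5`).
**`stepT d F`** is the largest `m` allowed by both constraints, **`triBound10`** the recursion from the kernels
`6 → 10` (S1TriangleKernelSix) and `7 → 12` (S1TriangleKernelSeven): `0, 1, 2, 4, 6, 8, 10, 12, 15, 19, 23, 28, 34, 40,
47, 55, 64, 74, …` — `15` against `18` (p9's chain) and `19` (triBound8) at `ν = 8`, `23` against `27` at `ν = 10`,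
`28` against `33` at `ν = 11`: what the cells `(36, 8)`, `(36, 10)`, `(36, 11)` of level `7` need. Here the definitions,
the recursion (`triBound10_succ`, `7 ≤ d`), the two halves of the value of `stepT` (`le_stepT_of`, `stepT_eq_of`), the
step of the values (`triBound10_succ_eq`), monotonicity and the values `d ≤ 7`. Axioms: standard.
-/

namespace PercRepro

namespace S1

/-- The predicate of the (C3)-refined step at nullity `d + 1` from the bound `F` at nullity `d`: the star constraint
`2m² ≤ 2m + 3F` and the restriction constraint `m ≤ 2 ∨ (d + 3)·m ≤ 3F`. -/
abbrev StepOK10 (d F m : ℕ) : Prop :=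
  2 * m * m ≤ 2 * m + 3 * F ∧ (m ≤ 2 ∨ (d + 3) * m ≤ 3 * F)

/-- **The refined step**: the largest `m ≤ 3F + 2` with `StepOK10 d F m`. -/
def stepT (d F : ℕ) : ℕ := Nat.findGreatest (StepOK10 d F) (3 * F + 2)

/-- **The bootstrap from the kernels**: `triBound10 ν = triBound8 ν` for `ν ≤ 5`, `triBound10 6 = 10`, `triBound10 7 = 12`
(the kernels at nullities `6` and `7`), and `triBound10 (ν + 1) = triBound10 ν + stepT ν (triBound10 ν)` from `ν = 7` on. -/
def triBound10 : ℕ → ℕ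
  | 0 => 0
  | 1 => 1
  | 2 => 2
  | 3 => 4
  | 4 => 6
  | 5 => 8
  | 6 => 10
  | 7 => 12
  | d + 8 => triBound10 (d + 7) + stepT (d + 7) (triBound10 (d + 7))

/-- The recursion of `triBound10` from `ν = 7` on. -/
theorem triBound10_succ (d : ℕ) (hd : 7 ≤ d) :
    triBound10 (d + 1) = triBound10 d + stepT d (triBound10 d) := by
  obtain ⟨k, rfl⟩ := Nat.exists_eq_add_of_le hd
  rw [show 7 + k + 1 = k + 8 by omega, show 7 + k = k + 7 by omega]
  rfl

/-- The search bound of `stepT` is safe: `StepOK10 d F m` forces `m ≤ 3F + 2`. -/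
theorem le_of_stepOK10 {d F m : ℕ} (h : StepOK10 d F m) : m ≤ 3 * F + 2 := by
  obtain ⟨h1, -⟩ := h
  by_contra hlt
  push Not at hlt
  nlinarith [h1, hlt]

/-- **The lower half**: an allowed `m` is at most `stepT d F`. -/
theorem le_stepT_of {d F m : ℕ} (h : StepOK10 d F m) : m ≤ stepT d F :=
  Nat.le_findGreatest (le_of_stepOK10 h) h

/-- **The value of `stepT`**: if `StepOK10 d F t` with `2 ≤ t`, and the step `t + 1` violates the star constraint or the
restriction constraint, then `stepT d F = t`. -/
theorem stepT_eq_of {d F t : ℕ} (ht : 2 ≤ t) (h1 : StepOK10 d F t)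
    (h2 : 2 * (t + 1) + 3 * F < 2 * (t + 1) * (t + 1) ∨ 3 * F < (d + 3) * (t + 1)) : stepT d F = t := by
  unfold stepT
  rw [Nat.findGreatest_eq_iff]
  refine ⟨le_of_stepOK10 h1, fun _ => h1, fun n hn _ hP => ?_⟩
  obtain ⟨hPa, hPb⟩ := hP
  rcases h2 with h2 | h2
  · have hmono : 2 * (t + 1) * (t + 1) ≤ 2 * (t + 1) + 3 * F := by nlinarith [hPa, hn]
    omega
  · rcases hPb with h | h
    · omega
    · have : (d + 3) * (t + 1) ≤ (d + 3) * n := Nat.mul_le_mul_left (d + 3) hn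
      omega

/-- **The step of the values**: for `7 ≤ d`, if `triBound10 d = F`, `StepOK10 d F t` with `2 ≤ t`, and `t + 1` violates
one of the two constraints, then `triBound10 (d + 1) = F + t`. -/
theorem triBound10_succ_eq {d F t : ℕ} (hd : 7 ≤ d) (hF : triBound10 d = F) (ht : 2 ≤ t) (h1 : StepOK10 d F t)
    (h2 : 2 * (t + 1) + 3 * F < 2 * (t + 1) * (t + 1) ∨ 3 * F < (d + 3) * (t + 1)) :
    triBound10 (d + 1) = F + t := by
  rw [triBound10_succ d hd, hF, stepT_eq_of ht h1 h2]

/-- `triBound10` never decreases. -/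
theorem triBound10_le_succ (d : ℕ) : triBound10 d ≤ triBound10 (d + 1) := by
  rcases Nat.lt_or_ge d 7 with h | h
  · interval_cases d <;> decide
  · rw [triBound10_succ d h]
    exact Nat.le_add_right _ _

/-- `triBound10` is monotone. -/
theorem triBound10_mono {d d' : ℕ} (h : d ≤ d') : triBound10 d ≤ triBound10 d' :=
  monotone_nat_of_le_succ triBound10_le_succ h

/-- `triBound10 d = triBound8 d` for `d ≤ 5`. -/
theorem triBound10_eq_triBound8_of_le_five {d : ℕ} (hd : d ≤ 5) : triBound10 d = triBound8 d := by
  interval_cases d <;> rfl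

/-- `triBound10 6 = 10`. -/
theorem triBound10_val_6 : triBound10 6 = 10 := rfl

/-- `triBound10 7 = 12`. -/
theorem triBound10_val_7 : triBound10 7 = 12 := rfl

/-- `triBound10 8 = 15` (`stepT 7 12 = 3`: `m = 4` fails `10·4 ≤ 36`). -/
theorem triBound10_val_8 : triBound10 8 = 15 :=
  triBound10_succ_eq (t := 3) (by norm_num) triBound10_val_7 (by norm_num) (by decide) (Or.inr (by norm_num))

end S1

end PercRepro
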